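import Mathlib
import Summits.Parity.BatemanHorn.Theses.PolynomialMobius
import Summits.Parity.BatemanHorn.Theses.IsogenyRedei
import Summits.Parity.BatemanHorn.Theorems.PolynomialMobiusPolyMobiusTailCoreExact
import Summits.Parity.BatemanHorn.Theorems.PolynomialMobiusPolyMobiusTailSummitEquivalence

/-!
# Crux stmt-Parity-0870 `PolyMobiusTail` — skeleton v6.1 of line `eta-free-multilinear-window`
# (piece file `Lines/stub_large.lean`; lead prover-line-stmt-Parity-0870-c7-0, 2026-08-17; §C by lead c8)

v6.1 (lead c8, 2026-08-17T13Z) = v6 with the four registered stubs and the composition BYTE-IDENTICAL,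
plus §C: the landed SUMMIT-EQUIVALENCE certificate p161759
`Theorems/PolynomialMobiusPolyMobiusTailSummitEquivalence.lean` — `PolyMobiusTail ↔ BatemanHorn` (the
sub-problem statement, count form, BY NAME; `←` new: count-BH ⟹ Λ-BH per system by the reverse
partial-summation sandwich p161372 + Bombieri–Pila, then `Negative.polyMobiusTail_iff_lambdaBatemanHorn`).
Consequence recorded in §C: the four stubs of this skeleton prove `BatemanHorn` itself
(`batemanHorn_of_stubs`), and conversely `BatemanHorn` gives the core stub S4a′ back modulo the
parity-free stubs (`stub_large_core_small_of_batemanHorn`) — the line is a decomposition of the SUMMIT.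

v5 (leads c5/c6; re-keyed by planner-skel as `Lines/stub_large.lean` @d85d15881062, sha 20377f74…)
concluded the crux from four registered stubs S4a `stub_large_core` (core, ALL `0 < δ < θ < 1`), S4b
`stub_large_band_three_le`, S2 `stub_window_linear_three_le`, S3 `stub_window_nonlinear` (windows,
EXISTENTIAL in `(θ, η)`).  REPORT-c6 flagged that S4a's `∀ θ` form is consumed only at the window exponent
and may be STRONGER than the crux slice for large `θ`.  Lead c7 landed the two certificates that settle the
sizing BY THEOREM —

* p158153 `Theorems/PolynomialMobiusPolyMobiusTailCoreStrength.lean`: S4a, already for `(X, X+2)`, proves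
  `π₂(x) ∼ 2C₂x/(log x)²` and `TwinPrimeConjecture`; on every linear pair the core at `θ ≤ c(f)` is
  EQUIVALENT to the pair's `Λ`-Hardy–Littlewood asymptotic (`core_iff_lambda_pair`); the landed pair window
  holds UNIFORMLY for all `θ, η ∈ (0, c(f)]` (`window_linear_pair_uniform`);
* p158707 `Theorems/PolynomialMobiusPolyMobiusTailCoreExact.lean`: the exact core
  `CoreSmall(f) : ∃ θ₀ ∈ (0,1), ∀ 0 < θ ≤ θ₀, ∀ 0 < δ < θ, Core_{θ,δ}(f) = o(x)` satisfies, modulo UNIFORM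
  windows and the band, `(∀ f, CoreSmall f) ⟹ PolyMobiusTail` (`polyMobiusTail_of_coreSmall`) AND
  `PolyMobiusTail ⟹ (∀ f, CoreSmall f)` (`coreSmall_of_polyMobiusTail`); on linear pairs
  `CoreSmall(f) ⟺ Λ-Hardy–Littlewood(f)` outright (`coreSmall_iff_lambda_pair`, `coreSmall_twin_iff`) —

and RESHAPES the skeleton accordingly (v6, this file): the core stub becomes the exact `CoreSmall` for all
systems, and the two open window stubs are stated in the UNIFORM form in which every landed window is
actually proved (`k ≤ 1`: `CoreExact.uniformWindow_of_le_one`; pairs: `CoreStrength.window_linear_pair_uniform`).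
New names, so that no consumer keyed on the v5 names reads a changed statement under an old name.

## Registered stubs of v6 (sorries = exactly these four)

* S4a′ `stub_large_core_small`  — the EXACT parity core, every Bateman–Horn system (open; summit-in-kind:
  on `(X, X+2)` it IS the Hardy–Littlewood twin asymptotic, `CoreExact.coreSmall_twin_iff`).  Implied by the
  v5 stub S4a (`stub_large_core_small_of_forall` below), so any proof of S4a still closes it.
* S4b  `stub_large_band_three_le` — VERBATIM v5 (hyper-incomplete band, total degree `≥ 3`; parity-free
  in kind, open even with `μ ↦ 1`).
* S2u  `stub_window_linear_three_le_uniform` — `k ≥ 3` linear window, uniform in `(θ, η)` (open,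
  parity-free: cyclic Kloosterman fractions with modulus-entangled numerators, not in print).
* S3u  `stub_window_nonlinear_uniform` — window for a member of degree `≥ 2`, uniform (open, parity-free;
  `X²+1` slice behind stmt-Parity-12214/12215, degree `≥ 3` tool-less).

Composition `PolyMobiusTail_of` = the LANDED `CoreExact.polyMobiusTail_of_coreSmall` applied to the four
stubs (the `k ≤ 1` and pair windows, the low-degree band p154483, the localisations p138374/p155041 are
inside it); twin for IsogenyRedei.  EXACTNESS (landed, `CoreExact.coreSmall_of_polyMobiusTail`): modulo
S2u ∧ S3u ∧ S4b the crux implies S4a′ back — no registered stub of v6 is known to exceed the crux except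
through the other open stubs.

Disproof used: `Cruxes/PolyMobiusTail/Disproof.lean` (sha a1f48fa0…, unchanged since 2026-08-16T06:20Z,
§6 Targets empty): only `polyMobiusTail_false_without_nonAssoc` — every stub keeps the full
`IsBatemanHornSystem f` (non-association is load-bearing at S4a′: on `(X, X)` the core carries the
`Σ μ(n)² log² n` mass).  Landed `Negative/*` checked: stubs are SIGNED sums over ALL divisor tuples with the
tail cut `η`-free and `θ < 1` (`polyMobiusTail_abs_false`, `_primeDivisors_false`, `_allEtaClosed_false`
do not bite); `Negative.Equivalence` honoured (S4a′ is openly crux-strength on pairs).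
-/

open scoped BigOperators Topology
open Filter Finset Polynomial Asymptotics

namespace Summit.Parity.BatemanHorn.Cruxes.PolyMobiusTail.LargePart

open Literature.NumberTheory.Sieve
open Summit.Parity.BatemanHorn.Theorems.PolyMobiusTail.EtaFreeWindow

/-! ## §A  The four registered stubs of v6 -/

/-- **S4a′ · `stub_large_core_small` — the EXACT parity core (open; every system).**  For every
Bateman–Horn system there is `θ₀ = θ₀(f) ∈ (0,1)` such that for all `0 < θ ≤ θ₀` and `0 < δ < θ` the
cofactor large part of the Möbius tail on COMPLETE pencils is `o(x)`:
`Σ_{n≤x} Σ_{eᵢ ∣ fᵢ(n), ∏ fᵢ(n)/eᵢ > x^{1+θ}, ∏ eᵢ ≤ x^{1-δ}} ∏ μ(fᵢ(n)/eᵢ) log(fᵢ(n)/eᵢ) = o(x)`.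
Grouped by the cofactor tuple `e` this is Möbius cancellation of the large cofactors along the pencils
`n ≡ r (mod ∏eᵢ)` of length `≥ x^{δ}` — the parity statement proper.  Exact strength (landed): on every
linear pair ⟺ the pair's `Λ`-Hardy–Littlewood asymptotic (`CoreExact.coreSmall_iff_lambda_pair`; for
`(X, X+2)` ⟺ `Σ Λ(n)Λ(n+2) ∼ 2C₂x`, `coreSmall_twin_iff`); for all systems, modulo the windows S2u/S3u and
the band S4b, ⟺ the crux (`CoreExact.polyMobiusTail_of_coreSmall` / `coreSmall_of_polyMobiusTail`).  Why it
might fail: only if Bateman–Horn (Λ-form) fails on some system; the risk is hardness (Selberg / Bombieri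
parity indeterminacy: `Literature.Barriers.Parity.SelbergParityBarrier`, `FordFixedLevelBarrier`), not
falsity.  Size: XL (summit-in-kind).  Sources: BombieriAsymptoticSieve1976; Ford2005; arXiv:2008.09905 §1.3;
`Cruxes/PolyMobiusTail/STRATEGY-CENSUS.md` gen 4 D20; REPORT-c6, REPORT-c7. -/
theorem stub_large_core_small : ∀ (k : ℕ) (f : Fin k → ℤ[X]), IsBatemanHornSystem f →
    ∃ θ₀ : ℝ, 0 < θ₀ ∧ θ₀ < 1 ∧ ∀ θ δ : ℝ, 0 < θ → θ ≤ θ₀ → 0 < δ → δ < θ →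
      (fun x : ℕ => ∑ n ∈ Finset.Icc 1 x,
        ∑ e ∈ Fintype.piFinset (fun i => (((f i).eval (n : ℤ)).toNat).divisors),
          if (x : ℝ) ^ (1 + θ) < ∏ i, ((((f i).eval (n : ℤ)).toNat / e i : ℕ) : ℝ) ∧
              ∏ i, (e i : ℝ) ≤ (x : ℝ) ^ (1 - δ) then
            ∏ i, ((ArithmeticFunction.moebius (((f i).eval (n : ℤ)).toNat / e i) : ℝ) *
              Real.log ((((f i).eval (n : ℤ)).toNat / e i : ℕ) : ℝ)) else 0)
        =o[atTop] fun x : ℕ => (x : ℝ) := by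
  sorry

/-- **S4b · `stub_large_band_three_le` — the HYPER-INCOMPLETE BAND, total degree `G ≥ 3` (open; VERBATIM
the v5 registered stub).**  For every Bateman–Horn system with `∑ deg fᵢ ≥ 3` and `0 < δ < θ < 1`:
`Σ_{n≤x} Σ_{eᵢ ∣ fᵢ(n), ∏ fᵢ(n)/eᵢ > x^{1+θ}, ∏ eᵢ > x^{1-δ}} ∏ μ(fᵢ(n)/eᵢ) log(fᵢ(n)/eᵢ) = o(x)`.
No complete variable on either factorisation side; parity-free in kind (open with `μ ↦ 1`: divisor-type
correlations at the Pólya–Vinogradov threshold, Blomer, Bull. LMS 49 (2017)); consistent with the random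
model (no main term), so no cheap refutation.  For `G ≤ 2` the band is EMPTY (landed p154483).
Size: L/XL.  Sources: Blomer2017; census gen 4 D20 / T12; arXiv:2008.09905 §1.3. -/
theorem stub_large_band_three_le : ∀ (k : ℕ) (f : Fin k → ℤ[X]), IsBatemanHornSystem f →
    3 ≤ ∑ i, (f i).natDegree → ∀ θ δ : ℝ, 0 < θ → θ < 1 → 0 < δ → δ < θ →
    (fun x : ℕ => ∑ n ∈ Finset.Icc 1 x,
      ∑ e ∈ Fintype.piFinset (fun i => (((f i).eval (n : ℤ)).toNat).divisors),
        if (x : ℝ) ^ (1 + θ) < ∏ i, ((((f i).eval (n : ℤ)).toNat / e i : ℕ) : ℝ) ∧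
            (x : ℝ) ^ (1 - δ) < ∏ i, (e i : ℝ) then
          ∏ i, ((ArithmeticFunction.moebius (((f i).eval (n : ℤ)).toNat / e i) : ℝ) *
            Real.log ((((f i).eval (n : ℤ)).toNat / e i : ℕ) : ℝ)) else 0)
      =o[atTop] fun x : ℕ => (x : ℝ) := by
  sorry

/-- **S2u · `stub_window_linear_three_le_uniform` — WINDOW, linear systems with `k ≥ 3`, uniform in the
cut-offs (open, parity-free).**  For a Bateman–Horn system of `k ≥ 3` members of degree `≤ 1` there is
`c ∈ (0,1)` with `Σ_{n≤x} Σ_{dᵢ∣fᵢ(n), x^{1-η} < ∏dᵢ ≤ x^{1+θ}} ∏ μ(dᵢ) log dᵢ = o(x)` for ALL `θ, η ∈ (0,c]`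
(the form in which the `k ≤ 2` windows are theorems: `CoreExact.uniformWindow_of_le_one`,
`CoreStrength.window_linear_pair_uniform`).  Corner (coordinates other than the largest with product
`≤ x^σ`): Bombieri–Vinogradov template of p146909 but with coefficient-uniform pair estimates and
CRT-varying residues; interior: cyclic trilinear Kloosterman fractions with modulus-entangled numerators —
not in print (census gen 4 S12a; `Cruxes/PolyMobiusTail/StrategistS1Sketch.lean`).  Even complete, the crux
slice still needs S4a′ (p138374).  Size: XL.  Sources: DukeFriedlanderIwaniec1997; BarrierNotesIdeator4 §B20. -/
theorem stub_window_linear_three_le_uniform : ∀ (k : ℕ) (f : Fin k → ℤ[X]), IsBatemanHornSystem f →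
    3 ≤ k → (∀ i, (f i).natDegree ≤ 1) →
    ∃ c : ℝ, 0 < c ∧ c < 1 ∧ ∀ θ η : ℝ, 0 < θ → θ ≤ c → 0 < η → η ≤ c →
      (fun x : ℕ => ∑ n ∈ Finset.Icc 1 x,
        ∑ d ∈ Fintype.piFinset (fun i => (((f i).eval (n : ℤ)).toNat).divisors),
          if (x : ℝ) ^ (1 - η) < ∏ i, (d i : ℝ) ∧ ∏ i, (d i : ℝ) ≤ (x : ℝ) ^ (1 + θ) then
            ∏ i, ((ArithmeticFunction.moebius (d i) : ℝ) * Real.log (d i)) else 0)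
        =o[atTop] fun x : ℕ => (x : ℝ) := by
  sorry

/-- **S3u · `stub_window_nonlinear_uniform` — WINDOW, systems with a member of degree `≥ 2`, uniform in
the cut-offs (open, parity-free).**  For a Bateman–Horn system with some `deg fᵢ ≥ 2` there is `c ∈ (0,1)`
with the window `(x^{1-η}, x^{1+θ}]` of the Möbius tail `o(x)` for ALL `θ, η ∈ (0,c]`.  For `X²+1` this is
μ-twisted equidistribution of the roots of `n² + 1 (mod d)` at the threshold `d ≍ x` — after Vaughan the
balanced bilinear root-fraction bound stmt-Parity-12214 `RootFractionsBound` / 12215 `RootLevelBeyondHalf`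
(route GaussianFractions, OPEN); degree `≥ 3` members: no tool (roots of higher-degree congruences).
Size: XL.  Sources: DukeFriedlanderIwaniec1995 (roots of quadratic congruences), arXiv:2008.09905 §1.3,
census gen 4. -/
theorem stub_window_nonlinear_uniform : ∀ (k : ℕ) (f : Fin k → ℤ[X]), IsBatemanHornSystem f →
    (∃ i, 2 ≤ (f i).natDegree) →
    ∃ c : ℝ, 0 < c ∧ c < 1 ∧ ∀ θ η : ℝ, 0 < θ → θ ≤ c → 0 < η → η ≤ c →
      (fun x : ℕ => ∑ n ∈ Finset.Icc 1 x,
        ∑ d ∈ Fintype.piFinset (fun i => (((f i).eval (n : ℤ)).toNat).divisors),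
          if (x : ℝ) ^ (1 - η) < ∏ i, (d i : ℝ) ∧ ∏ i, (d i : ℝ) ≤ (x : ℝ) ^ (1 + θ) then
            ∏ i, ((ArithmeticFunction.moebius (d i) : ℝ) * Real.log (d i)) else 0)
        =o[atTop] fun x : ℕ => (x : ℝ) := by
  sorry

/-! ## §B  Composition (a landed theorem) and book-keeping -/

/-- **Composition (PROVED modulo the four registered stubs; the proof is the LANDED
`CoreExact.polyMobiusTail_of_coreSmall`, p158707).** The crux of route PolynomialMobius, BY NAME. -/
theorem PolyMobiusTail_of : Summit.Parity.BatemanHorn.Theses.PolynomialMobius.PolyMobiusTail :=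
  CoreExact.polyMobiusTail_of_coreSmall stub_large_core_small stub_large_band_three_le
    stub_window_linear_three_le_uniform stub_window_nonlinear_uniform

/-- The identical decl of route IsogenyRedei (and, verbatim, CyclotomicTower / CrossedSalie /
GaussianFractions — the five routes sharing stmt-Parity-0870). -/
theorem PolyMobiusTail_of_isogenyRedei : Summit.Parity.BatemanHorn.Theses.IsogenyRedei.PolyMobiusTail :=
  PolyMobiusTail_of

/-- **The piece `stub_large`, v6 form `LargeSmall` (DERIVED from S4a′ ∧ S4b ∧ landed S4c):** for every
Bateman–Horn system there is `θ₀ ∈ (0,1)` such that for all `0 < θ ≤ θ₀` the cofactor LARGE part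
`Σ_{n≤x} Σ_{eᵢ ∣ fᵢ(n), ∏ fᵢ(n)/eᵢ > x^{1+θ}} ∏ μ(fᵢ(n)/eᵢ) log(fᵢ(n)/eᵢ)` is `o(x)` (`Large_θ = Core_{θ,θ/2} +
Band_{θ,θ/2}`, p155041 `large_eq_core_add_band`; band by `CoreExact.band_of_pieces`).  The v4 piece signature
(`∀ θ ∈ (0,1)`) is superseded for the same reason as S4a: only small `θ` is consumed, and only small `θ` is
given back by the crux. -/
theorem stub_large_small_derived : ∀ (k : ℕ) (f : Fin k → ℤ[X]), IsBatemanHornSystem f →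
    ∃ θ₀ : ℝ, 0 < θ₀ ∧ θ₀ < 1 ∧ ∀ θ : ℝ, 0 < θ → θ ≤ θ₀ →
      (fun x : ℕ => ∑ n ∈ Finset.Icc 1 x,
        ∑ e ∈ Fintype.piFinset (fun i => (((f i).eval (n : ℤ)).toNat).divisors),
          if (x : ℝ) ^ (1 + θ) < ∏ i, ((((f i).eval (n : ℤ)).toNat / e i : ℕ) : ℝ) then
            ∏ i, ((ArithmeticFunction.moebius (((f i).eval (n : ℤ)).toNat / e i) : ℝ) *
              Real.log ((((f i).eval (n : ℤ)).toNat / e i : ℕ) : ℝ)) else 0)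
        =o[atTop] fun x : ℕ => (x : ℝ) := by
  intro k f hf
  obtain ⟨θ₀, h₀0, h₀1, hC⟩ := stub_large_core_small k f hf
  refine ⟨θ₀, h₀0, h₀1, fun θ hθ0 hθle => ?_⟩
  have hθ1 : θ < 1 := lt_of_le_of_lt hθle h₀1
  have hCore := hC θ (θ / 2) hθ0 hθle (by linarith) (by linarith)
  have hBand := CoreExact.band_of_pieces stub_large_band_three_le f hf θ (θ / 2) hθ0 hθ1
    (by linarith) (by linarith)
  exact (hCore.add hBand).congr_left fun x => (large_eq_core_add_band f θ (θ / 2) x).symm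

/-- **Backward compatibility: the v5 stub S4a implies S4a′** (so a proof of the v5 `stub_large_core`,
signature verbatim as the hypothesis, still closes the core stub of v6; `CoreExact.coreSmall_of_core_forall`). -/
theorem stub_large_core_small_of_forall
    (hS4a : ∀ (k : ℕ) (f : Fin k → ℤ[X]), IsBatemanHornSystem f → ∀ θ δ : ℝ,
      0 < θ → θ < 1 → 0 < δ → δ < θ →
      (fun x : ℕ => ∑ n ∈ Finset.Icc 1 x,
        ∑ e ∈ Fintype.piFinset (fun i => (((f i).eval (n : ℤ)).toNat).divisors),
          if (x : ℝ) ^ (1 + θ) < ∏ i, ((((f i).eval (n : ℤ)).toNat / e i : ℕ) : ℝ) ∧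
              ∏ i, (e i : ℝ) ≤ (x : ℝ) ^ (1 - δ) then
            ∏ i, ((ArithmeticFunction.moebius (((f i).eval (n : ℤ)).toNat / e i) : ℝ) *
              Real.log ((((f i).eval (n : ℤ)).toNat / e i : ℕ) : ℝ)) else 0)
        =o[atTop] fun x : ℕ => (x : ℝ)) :
    ∀ (k : ℕ) (f : Fin k → ℤ[X]), IsBatemanHornSystem f →
      ∃ θ₀ : ℝ, 0 < θ₀ ∧ θ₀ < 1 ∧ ∀ θ δ : ℝ, 0 < θ → θ ≤ θ₀ → 0 < δ → δ < θ →
      (fun x : ℕ => ∑ n ∈ Finset.Icc 1 x,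
        ∑ e ∈ Fintype.piFinset (fun i => (((f i).eval (n : ℤ)).toNat).divisors),
          if (x : ℝ) ^ (1 + θ) < ∏ i, ((((f i).eval (n : ℤ)).toNat / e i : ℕ) : ℝ) ∧
              ∏ i, (e i : ℝ) ≤ (x : ℝ) ^ (1 - δ) then
            ∏ i, ((ArithmeticFunction.moebius (((f i).eval (n : ℤ)).toNat / e i) : ℝ) *
              Real.log ((((f i).eval (n : ℤ)).toNat / e i : ℕ) : ℝ)) else 0)
        =o[atTop] fun x : ℕ => (x : ℝ) :=
  fun k f hf => CoreExact.coreSmall_of_core_forall f (hS4a k f hf)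

/-- **Exactness of v6 (landed, `CoreExact.coreSmall_of_polyMobiusTail`): modulo S2u ∧ S3u ∧ S4b the crux
gives S4a′ back** — the core stub of v6 does not exceed the crux except through the other open stubs. -/
theorem stub_large_core_small_of_crux
    (hTail : Summit.Parity.BatemanHorn.Theses.PolynomialMobius.PolyMobiusTail) :
    ∀ (k : ℕ) (f : Fin k → ℤ[X]), IsBatemanHornSystem f →
      ∃ θ₀ : ℝ, 0 < θ₀ ∧ θ₀ < 1 ∧ ∀ θ δ : ℝ, 0 < θ → θ ≤ θ₀ → 0 < δ → δ < θ →
      (fun x : ℕ => ∑ n ∈ Finset.Icc 1 x,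
        ∑ e ∈ Fintype.piFinset (fun i => (((f i).eval (n : ℤ)).toNat).divisors),
          if (x : ℝ) ^ (1 + θ) < ∏ i, ((((f i).eval (n : ℤ)).toNat / e i : ℕ) : ℝ) ∧
              ∏ i, (e i : ℝ) ≤ (x : ℝ) ^ (1 - δ) then
            ∏ i, ((ArithmeticFunction.moebius (((f i).eval (n : ℤ)).toNat / e i) : ℝ) *
              Real.log ((((f i).eval (n : ℤ)).toNat / e i : ℕ) : ℝ)) else 0)
        =o[atTop] fun x : ℕ => (x : ℝ) :=
  CoreExact.coreSmall_of_polyMobiusTail hTail stub_large_band_three_le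
    stub_window_linear_three_le_uniform stub_window_nonlinear_uniform

/-! ## §C  Summit equivalence (landed certificate p161759, lead c8) -/

/-- **The crux is the summit conjunct** (landed `SummitEquivalence.polyMobiusTail_iff_batemanHorn`):
`PolyMobiusTail ↔ BatemanHorn` (count form, Bateman–Horn 1962 (1), by name). -/
theorem PolyMobiusTail_iff_batemanHorn :
    Summit.Parity.BatemanHorn.Theses.PolynomialMobius.PolyMobiusTail ↔ _root_.BatemanHorn :=
  Summit.Parity.BatemanHorn.Theorems.PolyMobiusTail.SummitEquivalence.polyMobiusTail_iff_batemanHorn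

/-- **The four registered stubs prove the SUMMIT conjunct `BatemanHorn`** (composition `PolyMobiusTail_of`
followed by the certificate). -/
theorem batemanHorn_of_stubs : _root_.BatemanHorn :=
  PolyMobiusTail_iff_batemanHorn.mp PolyMobiusTail_of

/-- **Exactness at summit level: `BatemanHorn` gives the core stub S4a′ back modulo S2u ∧ S3u ∧ S4b**
(certificate `←` then `stub_large_core_small_of_crux`). -/
theorem stub_large_core_small_of_batemanHorn (hBH : _root_.BatemanHorn) :
    ∀ (k : ℕ) (f : Fin k → ℤ[X]), IsBatemanHornSystem f →
      ∃ θ₀ : ℝ, 0 < θ₀ ∧ θ₀ < 1 ∧ ∀ θ δ : ℝ, 0 < θ → θ ≤ θ₀ → 0 < δ → δ < θ →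
      (fun x : ℕ => ∑ n ∈ Finset.Icc 1 x,
        ∑ e ∈ Fintype.piFinset (fun i => (((f i).eval (n : ℤ)).toNat).divisors),
          if (x : ℝ) ^ (1 + θ) < ∏ i, ((((f i).eval (n : ℤ)).toNat / e i : ℕ) : ℝ) ∧
              ∏ i, (e i : ℝ) ≤ (x : ℝ) ^ (1 - δ) then
            ∏ i, ((ArithmeticFunction.moebius (((f i).eval (n : ℤ)).toNat / e i) : ℝ) *
              Real.log ((((f i).eval (n : ℤ)).toNat / e i : ℕ) : ℝ)) else 0)
        =o[atTop] fun x : ℕ => (x : ℝ) :=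
  stub_large_core_small_of_crux (PolyMobiusTail_iff_batemanHorn.mpr hBH)

end Summit.Parity.BatemanHorn.Cruxes.PolyMobiusTail.LargePart
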